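import Literature.NumberTheory.EllipticCurves.QuadraticTwistMinimalModelProofs
import Literature.NumberTheory.EllipticCurves.QuadraticTwistTateFormProofs
import Literature.NumberTheory.EllipticCurves.SzpiroOfAbcProofs
import Literature.NumberTheory.EllipticCurves.SzpiroLocalDataProofs
import Literature.NumberTheory.EllipticCurves.MultiplicativeReductionJValuationProofs
import Literature.NumberTheory.DiophantineGeometry.GenEllMellReduction
import Literature.NumberTheory.DiophantineGeometry.ConductorMultiplicativeProofs
import Literature.NumberTheory.DiophantineGeometry.ConductorExponentZeroProofs
import Literature.NumberTheory.DiophantineGeometry.ConductorFactorizationProofs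
import Literature.NumberTheory.DiophantineGeometry.ConductorRadicalProofs
import Literature.NumberTheory.DiophantineGeometry.MinimalDiscriminantSmulProofs
import Literature.NumberTheory.DiophantineGeometry.MinimalDiscriminantNormProofs
import Mathlib.Analysis.SpecialFunctions.Log.Basic
import HarnessLib

/-!
# Crux `SingleTowerSzpiro` (stmt-ABC-22410), line `birth` — stub `stub_twistTransferOdd`

**Twist transfer at the odd places.** If every MULTIPLICATIVE tower obeys the budget
(`f_v = 1 ⇒ ord_v(Δ_min)·log p_v ≤ (6+ε) log N_E + C`, the statement of `stub_multiplicativeTower`),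
then so does every tower at an odd place `v` of ADDITIVE, POTENTIALLY MULTIPLICATIVE reduction
(`f_v ≠ 1`, `ord_v(j_E) < 0`), with the same `ε` and the same constant.

Proof. `p = p_v` odd, `p* = ±p ≡ 1 (4)`, `k = (p* − 1)/4`, `E₁ = E.twistModel k` (a model of `E ⊗ χ_{p*}`):
(1) `f_w(E₁) = f_w(E)` for `w ≠ v` (`conductorExponent_twistModel`); (2) `f_v(E₁) = 1`: some twist `E^{(d₀)}`
is multiplicative at `v` (`exists_hasMultiplicativeReductionAt_quadraticTwist_of_one_lt_valuation_j`),
`ord_v(d₀)` is odd (else `E` itself would be multiplicative), so `E ⊗ χ_{p*}` is a `v`-unramified twist of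
`E^{(d₀)}`; (3) `p · N_{E₁} ∣ N_E` (`f_v(E) ≥ 2`: bad since `ord_v(j) < 0`, not multiplicative by hypothesis);
(4) `ord_v Δ_min(E) ≤ ord_v Δ_min(E₁) + 6`: the twist model by `k` of a global minimal integral model of `E₁`
(`exists_baseChange_int_forall_isMinimalAt`) is an integral model of `E ⊗ χ_{p²} ≅ E` with discriminant
`p⁶ Δ`, and integral models bound `ord_v Δ_min` (`valuation_Δ_smul_le_of_isMinimalAt`). Hence
`tower_v(E) ≤ tower_v(E₁) + 6 log p ≤ (6+ε)(log N_E − log p) + C + 6 log p ≤ (6+ε) log N_E + C`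
(Silverman ATAEC IV.9.4 Step 7 / Ex. 4.37; AEC VII.1, X.5 Cor. 5.4).

HONESTY: bookkeeping of the line (the crux is equivalent to its multiplicative part at odd places), NOT progress
on the crux; abc is not proved by any of this; typed ≠ proved. No `sorry`, no new axiom, no `def`.
-/

noncomputable section

-- `Summit.<Summit>.<Problem>` is the mandated summit-side namespace (CONVENTIONS §2); for the
-- single-conjunct summit `ABC` the two coincide, so the duplicate `ABC.ABC` is deliberate.
set_option linter.dupNamespace false

namespace Summit.ABC.ABC.Theorems.SingleTowerSzpiroLine

open IsDedekindDomain Literature.NumberTheory.DiophantineGeometry Literature.NumberTheory.EllipticCurves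
open WeierstrassCurve Rat.HeightOneSpectrum

/-! ### Valuations of integers at the places of `ℤ` -/
/-- `|p_v|_v = exp(-1)`. [folklore] -/
theorem valuation_natGenerator (v : HeightOneSpectrum ℤ) :
    v.valuation ℚ ((natGenerator v : ℤ) : ℚ) = WithZero.exp (-1 : ℤ) := by
  rw [show ((natGenerator v : ℤ) : ℚ) = algebraMap ℤ ℚ (natGenerator v : ℤ) from (eq_intCast _ _).symm,
    HeightOneSpectrum.valuation_of_algebraMap]
  exact intValuation_natGenerator v

/-- `|±p_v|_w = 1` at every place `w ≠ v`. [folklore] -/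
theorem valuation_sign_mul_natGenerator_eq_one {v w : HeightOneSpectrum ℤ} (hw : w ≠ v) {s : ℤ}
    (hs : s = 1 ∨ s = -1) : w.valuation ℚ ((s * natGenerator v : ℤ) : ℚ) = 1 := by
  rw [Literature.NumberTheory.EllipticCurves.Rat.valuation_intCast_eq_one_iff]
  intro h
  have hq := prime_natGenerator w
  have hp := prime_natGenerator v
  have h' : natGenerator w ∣ natGenerator v := by
    have := Int.natAbs_dvd_natAbs.mpr h
    rcases hs with rfl | rfl <;> simpa using this
  have heq : natGenerator w = natGenerator v := (Nat.prime_dvd_prime_iff_eq hq hp).mp h'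
  exact hw (primesEquiv.injective (Subtype.ext heq))

/-! ### Elementary: `p* = ±p ≡ 1 (mod 4)` for an odd prime -/

/-- For an odd prime `p` there are `s = ±1` and `k ∈ ℤ` with `4k + 1 = s·p`. [folklore] -/
theorem exists_sign_four_mul_add_one {p : ℕ} (hp : p.Prime) (hp2 : p ≠ 2) :
    ∃ s k : ℤ, (s = 1 ∨ s = -1) ∧ 4 * k + 1 = s * p := by
  have hodd : p % 2 = 1 := Nat.odd_iff.mp (hp.odd_of_ne_two hp2)
  have : (p : ℤ) % 4 = 1 ∨ (p : ℤ) % 4 = 3 := by omega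
  rcases this with h | h
  · exact ⟨1, ((p : ℤ) - 1) / 4, Or.inl rfl, by omega⟩
  · exact ⟨-1, (-(p : ℤ) - 1) / 4, Or.inr rfl, by omega⟩

/-! ### Twist models over `ℚ`: ellipticity, `j`, multiplicative reduction transfers along isomorphisms -/

/-- `f_v = 1` is a `ℚ`-isomorphism invariant (multiplicative reduction is, and `f_v = 1` iff
multiplicative reduction). [folklore] -/
theorem conductorExponent_eq_one_iff_of_smul_eq (v : HeightOneSpectrum ℤ) {W W' : WeierstrassCurve ℚ}
    [W.IsElliptic] [W'.IsElliptic] (C : VariableChange ℚ) (h : C • W = W') :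
    W.conductorExponent v = 1 ↔ W'.conductorExponent v = 1 := by
  rw [WeierstrassCurve.conductorExponent_eq_one_iff_holds v W,
    WeierstrassCurve.conductorExponent_eq_one_iff_holds v W',
    ← hasMultiplicativeReductionAt_smul_iff_holds v W C, h]

/-- A `v`-adic unit `u` is an unramified twisting parameter: `k' = (u − 1)/4` has `|k'|_v ≤ 1` (at odd `v`)
and `4k' + 1 = u`; so the twist model by `k'` has the same conductor exponent at `v`. [folklore] -/
theorem conductorExponent_twistModel_of_unit (v : HeightOneSpectrum ℤ) (hp2 : natGenerator v ≠ 2)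
    (W : WeierstrassCurve ℚ) [W.IsElliptic] {u : ℚ} (hu : v.valuation ℚ u = 1) :
    (W.twistModel ((u - 1) / 4)).conductorExponent v = W.conductorExponent v := by
  have h4 : v.valuation ℚ (4 : ℚ) = 1 := by
    have := (Literature.NumberTheory.EllipticCurves.Rat.valuation_intCast_eq_one_iff v 4).mpr (by
      intro h
      have h2 : natGenerator v ∣ 4 := by exact_mod_cast h
      have := (Nat.prime_dvd_prime_iff_eq (prime_natGenerator v) Nat.prime_two).mp
        ((prime_natGenerator v).dvd_of_dvd_pow (show natGenerator v ∣ 2 ^ 2 by simpa using h2))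
      exact hp2 this)
    exact_mod_cast this
  refine conductorExponent_twistModel v W ?_ ?_
  · rw [map_div₀, h4, div_one]
    calc v.valuation ℚ (u - 1) ≤ max (v.valuation ℚ u) (v.valuation ℚ 1) := Valuation.map_sub _ _ _
      _ = 1 := by rw [hu, map_one, max_self]
  · have : 4 * ((u - 1) / 4) + 1 = u := by ring
    rw [this, hu]

/-! ### The twist by `p*`: its place `v` is multiplicative -/

/-- **At an odd additive, potentially multiplicative place, the twist by `p*` is multiplicative.**
For `E/ℚ` elliptic, `v ∤ 2` with `f_v(E) ≠ 1` and `ord_v(j_E) < 0`, and `4k + 1 = ±p_v`: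
`f_v(E.twistModel k) = 1`. [cite: SilvermanATAEC1994, IV.9.4 Step 7 and Ex. 4.37] -/
theorem conductorExponent_twistModel_pstar_eq_one (v : HeightOneSpectrum ℤ) (hp2 : natGenerator v ≠ 2)
    (W : WeierstrassCurve ℚ) [W.IsElliptic] (hf : W.conductorExponent v ≠ 1) (hj : 1 < v.valuation ℚ W.j)
    {s k : ℤ} (hs : s = 1 ∨ s = -1) (hk : 4 * k + 1 = s * natGenerator v)
    [(W.twistModel (k : ℚ)).IsElliptic] :
    (W.twistModel (k : ℚ)).conductorExponent v = 1 := by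
  set p : ℕ := natGenerator v with hpdef
  have hpp : p.Prime := prime_natGenerator v
  have hp0 : (p : ℚ) ≠ 0 := by exact_mod_cast hpp.ne_zero
  have hvp : v.valuation ℚ (p : ℚ) = WithZero.exp (-1 : ℤ) := by
    have := valuation_natGenerator v
    push_cast at this
    exact this
  have hvs : v.valuation ℚ (s : ℚ) = 1 := by
    rcases hs with rfl | rfl <;> simp
  have hkq : 4 * (k : ℚ) + 1 = (s : ℚ) * (p : ℚ) := by exact_mod_cast hk
  -- a twist `W^{(d₀)}` with multiplicative reduction at `v`
  obtain ⟨d₀, hd₀, hmult⟩ :=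
    WeierstrassCurve.exists_hasMultiplicativeReductionAt_quadraticTwist_of_one_lt_valuation_j v W hj
  haveI hE₀ : (W.quadraticTwist d₀).IsElliptic := isElliptic_quadraticTwist W hd₀
  have hf₀ : (W.quadraticTwist d₀).conductorExponent v = 1 :=
    (WeierstrassCurve.conductorExponent_eq_one_iff_holds v _).mpr hmult
  -- `|d₀|_v = exp(-m)`
  have hvd₀ : v.valuation ℚ d₀ ≠ 0 := (Valuation.ne_zero_iff _).mpr hd₀
  set m : ℤ := -WithZero.log (v.valuation ℚ d₀) with hm
  have hd₀v : v.valuation ℚ d₀ = WithZero.exp (-m) := by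
    rw [hm, neg_neg, WithZero.exp_log hvd₀]
  -- the unit part `u = d₀ · p^m`... written as `d₀ * p^(-m)`? We use `u := d₀ / p^m` with `zpow`.
  set u : ℚ := d₀ / (p : ℚ) ^ m with hudef
  have hpm : ((p : ℚ) ^ m) ≠ 0 := zpow_ne_zero _ hp0
  have hvpm : v.valuation ℚ ((p : ℚ) ^ m) = WithZero.exp (-m) := by
    rw [map_zpow₀, hvp, ← WithZero.exp_zsmul]; simp
  have hu : v.valuation ℚ u = 1 := by
    rw [hudef, map_div₀, hd₀v, hvpm, div_self (WithZero.exp_ne_zero)]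
  have hu0 : u ≠ 0 := fun h => by rw [h, map_zero] at hu; exact zero_ne_one hu
  have hd₀u : d₀ = u * (p : ℚ) ^ m := by rw [hudef, div_mul_cancel₀ _ hpm]
  -- parity of `m`
  rcases Int.even_or_odd m with ⟨m', hm'⟩ | ⟨m', hm'⟩
  · -- `m` even: `W^{(d₀)} ≅ W^{(u)} ≅ W.twistModel ((u-1)/4)`, so `f_v(W) = 1`: contradiction
    exfalso
    have hd₀' : d₀ = u * ((p : ℚ) ^ m') ^ 2 := by
      rw [hd₀u, hm', zpow_add₀ hp0, sq]
    -- `C₁ • W^{(u)} = W^{(d₀)}`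
    obtain ⟨C₁, hC₁⟩ := W.exists_variableChange_quadraticTwist_mul_sq u ((p : ℚ) ^ m') (zpow_ne_zero _ hp0)
    rw [← hd₀'] at hC₁
    -- `C₂ • W.twistModel k' = W^{(u)}`, `k' = (u-1)/4`
    obtain ⟨C₂, -, hC₂⟩ := W.exists_variableChange_twistModel_eq_quadraticTwist ((u - 1) / 4)
    have h4 : 4 * ((u - 1) / 4) + 1 = u := by ring
    rw [h4] at hC₂
    haveI : (W.quadraticTwist u).IsElliptic := isElliptic_quadraticTwist W hu0
    haveI : (W.twistModel ((u - 1) / 4)).IsElliptic :=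
      ⟨by rw [twistModel_Δ]; exact (IsUnit.mk0 _ (pow_ne_zero 6 (by rw [h4]; exact hu0))).mul W.isUnit_Δ⟩
    have h1 : (W.quadraticTwist u).conductorExponent v = 1 :=
      (conductorExponent_eq_one_iff_of_smul_eq v C₁ hC₁).mpr hf₀
    have h2 : (W.twistModel ((u - 1) / 4)).conductorExponent v = 1 :=
      (conductorExponent_eq_one_iff_of_smul_eq v C₂ hC₂).mpr h1
    rw [conductorExponent_twistModel_of_unit v hp2 W hu] at h2
    exact hf h2
  · -- `m` odd: `W^{(sp)} = (W^{(d₀)})^{(e)}` with `e = s p / d₀ = (s/u) · (p^(-m'))²`, a unit times a square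
    have hsp0 : (s : ℚ) * p ≠ 0 := mul_ne_zero (by rcases hs with rfl | rfl <;> simp) hp0
    -- `d₀ · ((s/u) · (p^(-m'))²) = s·p`
    have hcalc : (p : ℚ) ^ m * ((p : ℚ) ^ (-m')) ^ 2 = p := by
      rw [← zpow_natCast ((p : ℚ) ^ (-m')) 2, ← zpow_mul, ← zpow_add₀ hp0, hm']
      have : (2 * m' + 1 + -m' * ((2 : ℕ) : ℤ)) = (1 : ℤ) := by push_cast; ring
      rw [this, zpow_one]
    have hprod : d₀ * ((s : ℚ) / u * ((p : ℚ) ^ (-m')) ^ 2) = (s : ℚ) * p := by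
      rw [hd₀u]
      calc u * (p : ℚ) ^ m * ((s : ℚ) / u * ((p : ℚ) ^ (-m')) ^ 2)
          = (s : ℚ) * (u / u) * ((p : ℚ) ^ m * ((p : ℚ) ^ (-m')) ^ 2) := by ring
        _ = (s : ℚ) * p := by rw [div_self hu0, hcalc, mul_one]
    -- `(W^{(d₀)})^{(s/u)} ≅ (W^{(d₀)})^{((s/u)(p^(-m'))²)} = W^{(sp)} ≅ W.twistModel k`
    have hsu : v.valuation ℚ (s / u) = 1 := by rw [map_div₀, hvs, hu, div_one]
    have hsu0 : (s : ℚ) / u ≠ 0 := fun h => by rw [h, map_zero] at hsu; exact zero_ne_one hsu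
    obtain ⟨C₁, hC₁⟩ := (W.quadraticTwist d₀).exists_variableChange_quadraticTwist_mul_sq ((s : ℚ) / u)
      ((p : ℚ) ^ (-m')) (zpow_ne_zero _ hp0)
    conv_rhs at hC₁ => rw [quadraticTwist_quadraticTwist, hprod]
    -- `hC₁ : C₁ • (W^{(d₀)})^{(s/u)} = W^{(sp)}`
    obtain ⟨C₂, -, hC₂⟩ := (W.quadraticTwist d₀).exists_variableChange_twistModel_eq_quadraticTwist
      (((s : ℚ) / u - 1) / 4)
    have h4 : 4 * (((s : ℚ) / u - 1) / 4) + 1 = s / u := by ring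
    rw [h4] at hC₂
    -- `hC₂ : C₂ • (W^{(d₀)}).twistModel k'' = (W^{(d₀)})^{(s/u)}`
    obtain ⟨C₃, -, hC₃⟩ := W.exists_variableChange_twistModel_eq_quadraticTwist (k : ℚ)
    rw [hkq] at hC₃
    -- `hC₃ : C₃ • W.twistModel k = W^{(sp)}`
    haveI : ((W.quadraticTwist d₀).quadraticTwist ((s : ℚ) / u)).IsElliptic :=
      isElliptic_quadraticTwist _ hsu0
    haveI : ((W.quadraticTwist d₀).twistModel (((s : ℚ) / u - 1) / 4)).IsElliptic :=
      ⟨by rw [twistModel_Δ]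
          exact (IsUnit.mk0 _ (pow_ne_zero 6 (by rw [h4]; exact hsu0))).mul (W.quadraticTwist d₀).isUnit_Δ⟩
    haveI : (W.quadraticTwist ((s : ℚ) * p)).IsElliptic := isElliptic_quadraticTwist W hsp0
    have h1 : ((W.quadraticTwist d₀).twistModel (((s : ℚ) / u - 1) / 4)).conductorExponent v = 1 := by
      rw [conductorExponent_twistModel_of_unit v hp2 _ hsu]; exact hf₀
    have h2 : ((W.quadraticTwist d₀).quadraticTwist ((s : ℚ) / u)).conductorExponent v = 1 :=
      (conductorExponent_eq_one_iff_of_smul_eq v C₂ hC₂).mp h1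
    have h3 : (W.quadraticTwist ((s : ℚ) * p)).conductorExponent v = 1 :=
      (conductorExponent_eq_one_iff_of_smul_eq v C₁ hC₁).mp h2
    exact (conductorExponent_eq_one_iff_of_smul_eq v C₃ hC₃).mpr h3

/-! ### The twist by `p*`: discriminant and conductor bookkeeping -/

/-- **`ord_v Δ_min(E) ≤ ord_v Δ_min(E ⊗ χ_{p*}) + 6`**: the twist model (by the same `k`,
`4k + 1 = ±p`) of a global minimal integral model `W₀` of `E₁ = E.twistModel k` is an integral model of
`E ⊗ χ_{p²} ≅ E` with discriminant `p⁶ Δ(W₀)`, and an integral model bounds `ord_v Δ_min(E)` from above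
(Silverman AEC VII.1, VIII.8). [cite: SilvermanAEC2009, VII.1 (definition of minimality) and VIII.8 Cor. 8.3] -/
theorem ordMinimalDiscriminant_le_twist_add_six (v : HeightOneSpectrum ℤ) (W : WeierstrassCurve ℚ)
    [W.IsElliptic] {s k : ℤ} (hs : s = 1 ∨ s = -1) (hk : 4 * k + 1 = s * natGenerator v)
    [(W.twistModel (k : ℚ)).IsElliptic] :
    W.ordMinimalDiscriminant v ≤ (W.twistModel (k : ℚ)).ordMinimalDiscriminant v + 6 := by
  set p : ℕ := natGenerator v with hpdef
  have hpp : p.Prime := prime_natGenerator v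
  have hp0 : (p : ℚ) ≠ 0 := by exact_mod_cast hpp.ne_zero
  have hkq : 4 * (k : ℚ) + 1 = (s : ℚ) * (p : ℚ) := by exact_mod_cast hk
  have hs2 : (s : ℚ) ^ 2 = 1 := by rcases hs with rfl | rfl <;> norm_num
  set W₁ := W.twistModel (k : ℚ) with hW₁
  -- global minimal integer models of `W₁` and of `W`
  obtain ⟨C, W₀, hC, hmin⟩ := WeierstrassCurve.exists_baseChange_int_forall_isMinimalAt W₁
  obtain ⟨C', W₀', hC', hmin'⟩ := WeierstrassCurve.exists_baseChange_int_forall_isMinimalAt W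
  haveI hE₀ : (W₀.baseChange ℚ).IsElliptic := by rw [← hC]; infer_instance
  haveI hE₀' : (W₀'.baseChange ℚ).IsElliptic := by rw [← hC']; infer_instance
  -- `|Δ(W₀)|_v = exp(-ord_v Δ_min(W₁))`, `|Δ(W₀')|_v = exp(-ord_v Δ_min(W))`
  have h₁ : v.valuation ℚ (W₀.Δ : ℚ) = WithZero.exp (-(W₁.ordMinimalDiscriminant v : ℤ)) := by
    have h := valuation_Δ_eq_of_isMinimalAt_holds v (W₀.baseChange ℚ) (hmin v)
    rw [baseChange_int_Δ, ← hC, ordMinimalDiscriminant_smul_holds v W₁ C] at h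
    exact h
  have h₀ : v.valuation ℚ (W₀'.Δ : ℚ) = WithZero.exp (-(W.ordMinimalDiscriminant v : ℤ)) := by
    have h := valuation_Δ_eq_of_isMinimalAt_holds v (W₀'.baseChange ℚ) (hmin' v)
    rw [baseChange_int_Δ, ← hC', ordMinimalDiscriminant_smul_holds v W C'] at h
    exact h
  -- the integral model `X = (W₀.twistModel k) ⊗ ℚ` of `W`
  set X : WeierstrassCurve ℚ := (W₀.twistModel k).baseChange ℚ with hX
  have hXint : X.IsIntegralAt v := isIntegralAt_baseChange_int v _
  -- `X = D • (W₀' ⊗ ℚ)` for an explicit change of variables `D`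
  set k₂ : ℚ := 4 * (k : ℚ) * (k : ℚ) + (k : ℚ) + (k : ℚ) with hk₂
  have h4k₂ : 4 * k₂ + 1 = 1 * (p : ℚ) ^ 2 := by
    have : 4 * k₂ + 1 = (4 * (k : ℚ) + 1) ^ 2 := by rw [hk₂]; ring
    rw [this, hkq, mul_pow, hs2]
  obtain ⟨C₁, -, hC₁⟩ := W.exists_variableChange_twistModel_eq_quadraticTwist k₂
  rw [h4k₂] at hC₁
  obtain ⟨C₂, hC₂⟩ := W.exists_variableChange_quadraticTwist_mul_sq 1 (p : ℚ) hp0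
  obtain ⟨C₃, hC₃⟩ := W.exists_variableChange_quadraticTwist_one
  have hXeq : X = (VariableChange.twistMap (k : ℚ) C * C₁⁻¹ * C₂ * C₃ * C'⁻¹) • (W₀'.baseChange ℚ) := by
    rw [mul_smul, mul_smul, mul_smul, mul_smul, ← hC', inv_smul_smul, hC₃, hC₂, ← hC₁, inv_smul_smul,
      hk₂, ← twistModel_twistModel, ← hW₁, ← twistModel_smul, hC, hX]
    simp only [baseChange, map_twistModel, eq_intCast]
  -- minimality of `W₀' ⊗ ℚ` at `v`
  have hle := valuation_Δ_smul_le_of_isMinimalAt v (hmin' v)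
    (VariableChange.twistMap (k : ℚ) C * C₁⁻¹ * C₂ * C₃ * C'⁻¹) (hXeq ▸ hXint)
  rw [← hXeq, hX, baseChange_int_Δ, baseChange_int_Δ, twistModel_Δ, hk, h₀] at hle
  push_cast at hle
  have hvs : v.valuation ℚ (s : ℚ) = 1 := by rcases hs with rfl | rfl <;> simp
  have hvp : v.valuation ℚ (p : ℚ) = WithZero.exp (-1 : ℤ) := by
    have := valuation_natGenerator v
    push_cast at this
    exact this
  rw [map_mul, map_pow, map_mul, h₁, hvs, hvp, one_mul, ← WithZero.exp_nsmul, ← WithZero.exp_add,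
    WithZero.exp_le_exp] at hle
  simp only [smul_neg, nsmul_eq_mul, Nat.cast_ofNat, mul_one] at hle
  omega

/-- **The conductor exponents of `E ⊗ χ_{p*}` off `p` are those of `E`** (`p*` is a unit there).
[folklore] -/
theorem conductorExponent_twistModel_pstar_of_ne {v w : HeightOneSpectrum ℤ} (hw : w ≠ v)
    (W : WeierstrassCurve ℚ) [W.IsElliptic] {s k : ℤ} (hs : s = 1 ∨ s = -1)
    (hk : 4 * k + 1 = s * natGenerator v) :
    (W.twistModel (k : ℚ)).conductorExponent w = W.conductorExponent w := by
  refine conductorExponent_twistModel w W (by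
    rw [show ((k : ℤ) : ℚ) = algebraMap ℤ ℚ k from (eq_intCast _ k).symm]
    exact HeightOneSpectrum.valuation_le_one w k) ?_
  have : 4 * (k : ℚ) + 1 = ((s * natGenerator v : ℤ) : ℚ) := by push_cast; exact_mod_cast hk
  rw [this]
  exact valuation_sign_mul_natGenerator_eq_one hw hs

/-- **`p · N_{E ⊗ χ_{p*}} ∣ N_E`** at an odd additive potentially multiplicative place:
`f_v(E ⊗ χ_{p*}) = 1 ≤ f_v(E) − 1` and the other exponents agree. [folklore] -/
theorem natGenerator_mul_conductorNorm_twist_dvd (v : HeightOneSpectrum ℤ) (W : WeierstrassCurve ℚ)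
    [W.IsElliptic] {s k : ℤ} (hs : s = 1 ∨ s = -1) (hk : 4 * k + 1 = s * natGenerator v)
    [(W.twistModel (k : ℚ)).IsElliptic] (hf₁ : (W.twistModel (k : ℚ)).conductorExponent v = 1)
    (hf2 : 2 ≤ W.conductorExponent v) :
    natGenerator v * (W.twistModel (k : ℚ)).conductorNorm ℤ ∣ W.conductorNorm ℤ := by
  set W₁ := W.twistModel (k : ℚ) with hW₁
  have hpp : (natGenerator v).Prime := prime_natGenerator v
  have hN₁ : W₁.conductorNorm ℤ ≠ 0 := (conductorNorm_pos_holds W₁).ne'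
  have hN : W.conductorNorm ℤ ≠ 0 := (conductorNorm_pos_holds W).ne'
  rw [← Nat.factorization_le_iff_dvd (mul_ne_zero hpp.ne_zero hN₁) hN,
    Nat.factorization_mul hpp.ne_zero hN₁, hpp.factorization, Finsupp.le_def]
  have hinj : ∀ {a b : HeightOneSpectrum ℤ}, natGenerator a = natGenerator b → a = b :=
    fun h => primesEquiv.injective (Subtype.ext h)
  intro q
  rw [Finsupp.add_apply, Finsupp.single_apply]
  by_cases hq : q.Prime
  · set w : HeightOneSpectrum ℤ := (primesEquiv (R := ℤ)).symm ⟨q, hq⟩ with hw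
    have hwq : natGenerator w = q :=
      Literature.NumberTheory.EllipticCurves.Rat.natGenerator_primesEquiv_symm ⟨q, hq⟩
    rw [factorization_conductorNorm_primesEquiv_symm W₁ ⟨q, hq⟩,
      factorization_conductorNorm_primesEquiv_symm W ⟨q, hq⟩, ← hw]
    by_cases hqv : w = v
    · have hqp : natGenerator v = q := by rw [← hqv]; exact hwq
      rw [if_pos hqp, hqv, hf₁]
      omega
    · have hqp : natGenerator v ≠ q := fun h => hqv (hinj (hwq.trans h.symm))
      rw [if_neg hqp, zero_add, hW₁, conductorExponent_twistModel_pstar_of_ne hqv W hs hk]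
  · rw [Nat.factorization_eq_zero_of_not_prime _ hq, Nat.factorization_eq_zero_of_not_prime _ hq,
      if_neg (fun h : natGenerator v = q => hq (by rw [← h]; exact hpp)), zero_add]

/-- At a place with `ord_v(j) < 0` the reduction is bad: `f_v ≠ 0`. [folklore] -/
theorem conductorExponent_ne_zero_of_one_lt_valuation_j (v : HeightOneSpectrum ℤ)
    (W : WeierstrassCurve ℚ) [W.IsElliptic] (hj : 1 < v.valuation ℚ W.j) :
    W.conductorExponent v ≠ 0 := by
  intro h0
  have hgood := (WeierstrassCurve.conductorExponent_eq_zero_iff_holds v W).mp h0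
  exact absurd hj (not_lt.mpr (GenEll.valuation_j_le_one_of_hasGoodReduction_localMinimalModel v W hgood))

/-! ### The stub -/

/-- **Stub `stub_twistTransferOdd` of line `birth` (crux stmt-ABC-22410): twist transfer at the odd
places.** The multiplicative-tower bound implies the same bound (same `ε`, same constant) at every odd
place of additive, potentially multiplicative reduction. [cite: SilvermanATAEC1994, IV.9.4 Step 7 and Ex. 4.37] -/
theorem stub_twistTransferOdd : (∀ ε : ℝ, 0 < ε → ∃ C : ℝ, ∀ (W : WeierstrassCurve ℚ) [W.IsElliptic] (v : HeightOneSpectrum ℤ), W.conductorExponent v = 1 → (W.ordMinimalDiscriminant v : ℝ) * Real.log (Rat.HeightOneSpectrum.natGenerator v : ℝ) ≤ (6 + ε) * Real.log (W.conductorNorm ℤ : ℝ) + C) → ∀ ε : ℝ, 0 < ε → ∃ C : ℝ, ∀ (W : WeierstrassCurve ℚ) [W.IsElliptic] (v : HeightOneSpectrum ℤ), Rat.HeightOneSpectrum.natGenerator v ≠ 2 → W.conductorExponent v ≠ 1 → 1 < v.valuation ℚ W.j → (W.ordMinimalDiscriminant v : ℝ) * Real.log (Rat.HeightOneSpectrum.natGenerator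 v : ℝ) ≤ (6 + ε) * Real.log (W.conductorNorm ℤ : ℝ) + C := by
  intro h1 ε hε
  obtain ⟨C₁, hC₁⟩ := h1 ε hε
  refine ⟨C₁, fun W _ v hp2 hf hj => ?_⟩
  have hpp : (natGenerator v).Prime := prime_natGenerator v
  obtain ⟨s, k, hs, hk⟩ := exists_sign_four_mul_add_one hpp hp2
  have hkq : 4 * (k : ℚ) + 1 = (s : ℚ) * (natGenerator v : ℚ) := by exact_mod_cast hk
  have hsp0 : (s : ℚ) * (natGenerator v : ℚ) ≠ 0 :=
    mul_ne_zero (by rcases hs with rfl | rfl <;> simp) (by exact_mod_cast hpp.ne_zero)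
  haveI : (W.twistModel (k : ℚ)).IsElliptic :=
    ⟨by rw [twistModel_Δ]; exact (IsUnit.mk0 _ (pow_ne_zero 6 (by rw [hkq]; exact hsp0))).mul W.isUnit_Δ⟩
  set W₁ := W.twistModel (k : ℚ) with hW₁
  -- the four ingredients
  have hf₁ : W₁.conductorExponent v = 1 := conductorExponent_twistModel_pstar_eq_one v hp2 W hf hj hs hk
  have hf2 : 2 ≤ W.conductorExponent v := by
    have h0 := conductorExponent_ne_zero_of_one_lt_valuation_j v W hj
    omega
  have hord : W.ordMinimalDiscriminant v ≤ W₁.ordMinimalDiscriminant v + 6 :=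
    ordMinimalDiscriminant_le_twist_add_six v W hs hk
  have hdvd : natGenerator v * W₁.conductorNorm ℤ ∣ W.conductorNorm ℤ :=
    natGenerator_mul_conductorNorm_twist_dvd v W hs hk hf₁ hf2
  have htower₁ := hC₁ W₁ v hf₁
  -- real-number bookkeeping
  have hN : 0 < W.conductorNorm ℤ := conductorNorm_pos_holds W
  have hN₁ : 0 < W₁.conductorNorm ℤ := conductorNorm_pos_holds W₁
  have hN₁1 : (1 : ℝ) ≤ (W₁.conductorNorm ℤ : ℝ) := by exact_mod_cast hN₁
  have hp1 : (1 : ℝ) < (natGenerator v : ℝ) := by exact_mod_cast hpp.one_lt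
  have hlogp : 0 ≤ Real.log (natGenerator v : ℝ) := Real.log_nonneg hp1.le
  have hle : (natGenerator v : ℝ) * (W₁.conductorNorm ℤ : ℝ) ≤ (W.conductorNorm ℤ : ℝ) := by
    exact_mod_cast Nat.le_of_dvd hN hdvd
  have hlog : Real.log (natGenerator v : ℝ) + Real.log (W₁.conductorNorm ℤ : ℝ) ≤
      Real.log (W.conductorNorm ℤ : ℝ) := by
    rw [← Real.log_mul (by positivity) (by positivity)]
    exact Real.log_le_log (by positivity) hle
  have hordR : (W.ordMinimalDiscriminant v : ℝ) ≤ (W₁.ordMinimalDiscriminant v : ℝ) + 6 := by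
    exact_mod_cast hord
  have hε6 : (0 : ℝ) ≤ 6 + ε := by linarith
  calc (W.ordMinimalDiscriminant v : ℝ) * Real.log (natGenerator v : ℝ)
      ≤ ((W₁.ordMinimalDiscriminant v : ℝ) + 6) * Real.log (natGenerator v : ℝ) :=
        mul_le_mul_of_nonneg_right hordR hlogp
    _ = (W₁.ordMinimalDiscriminant v : ℝ) * Real.log (natGenerator v : ℝ) +
          6 * Real.log (natGenerator v : ℝ) := by ring
    _ ≤ (6 + ε) * Real.log (W₁.conductorNorm ℤ : ℝ) + C₁ + 6 * Real.log (natGenerator v : ℝ) := by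
        linarith
    _ ≤ (6 + ε) * (Real.log (W.conductorNorm ℤ : ℝ) - Real.log (natGenerator v : ℝ)) + C₁ +
          6 * Real.log (natGenerator v : ℝ) := by
        have : Real.log (W₁.conductorNorm ℤ : ℝ) ≤
            Real.log (W.conductorNorm ℤ : ℝ) - Real.log (natGenerator v : ℝ) := by linarith
        nlinarith [this, hε6]
    _ = (6 + ε) * Real.log (W.conductorNorm ℤ : ℝ) + C₁ - ε * Real.log (natGenerator v : ℝ) := by ring
    _ ≤ (6 + ε) * Real.log (W.conductorNorm ℤ : ℝ) + C₁ := by nlinarith [hlogp, hε]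

end Summit.ABC.ABC.Theorems.SingleTowerSzpiroLine

end
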